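import Summits.HubbardSuperconductivity.HubbardSuperconductivity.Theorems.BirComplexStableXY.Negative.BirComplexStableXYFalseOfStiffTwoLevelStructure
import Summits.HubbardSuperconductivity.HubbardSuperconductivity.Theorems.BalabanIRBirGappedPhaseReductionVacuous

/-!
# Route BalabanIR — support item `BirGappedPhaseReduction` (stmt-HubbardSuperconductivity-2082) closed MODULO `StiffTwoLevelStructure`

Bookkeeping update of `Theorems/BalabanIRBirGappedPhaseReductionVacuous.lean` for the CURRENT hypothesis of the engine's
negative lane.  The rev-0 reduction record `BirGappedPhaseReduction := BirComplexStableXY → BirGroundStateAverageLRO` is glue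
(`Theorems.not_birGappedPhaseReduction_iff : ¬ item ↔ engine ∧ ¬ target`); the negative line `theta-rotor-equimodular-zeros`
of crux stmt-HubbardSuperconductivity-2080 is closed modulo its spectral heart
`StiffTwoLevelStructure` (Beraha–Kahane–Weiss two-level normal form of the engine's partition function in the holomorphic
temporal-stiffness coordinate; `Theorems/BirComplexStableXY/Negative/BirComplexStableXYFalseOfStiffTwoLevelStructure.lean`,
`BirComplexStableXY_false_of_StiffTwoLevelStructure : StiffTwoLevelStructure → ¬ BirComplexStableXY`).  Composing with
ex falso: the SAME construction item `H = StiffTwoLevelStructure` settles stmt-2080 (refuted) and stmt-2082 (proved,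
vacuously) at once, exactly as the older hypothesis `WitnessZeroExists` does (`birGappedPhaseReduction_of_witnessZeroExists`).
Either hypothesis suffices (`birGappedPhaseReduction_of_witnessZeroExists_or_stiffTwoLevelStructure`).
This file imports `Theses.BalabanIR` transitively and is NOT a closing module (materialisation rule of the route: a closing
module states the item's body structurally, Theses-free); it is a `--supports stmt-HubbardSuperconductivity-2082` record.
No definition is introduced.
-/

set_option linter.dupNamespace false

namespace Summit.HubbardSuperconductivity.HubbardSuperconductivity.Theorems

open Summit.HubbardSuperconductivity.HubbardSuperconductivity.Theses.BalabanIR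
open Summit.HubbardSuperconductivity.BirComplexStableXYNegative

/-- `BirGappedPhaseReduction` (stmt-HubbardSuperconductivity-2082) holds modulo `StiffTwoLevelStructure`: the two-level
structure forces zeros of the engine's partition function for an admissible stiffness table, refuting the antecedent
`BirComplexStableXY`, so the implication holds vacuously. [folklore; composition of
`BirComplexStableXY_false_of_StiffTwoLevelStructure` with ex falso] -/
theorem birGappedPhaseReduction_of_stiffTwoLevelStructure (hS : StiffTwoLevelStructure) :
    BirGappedPhaseReduction :=
  fun hE => absurd hE (BirComplexStableXY_false_of_StiffTwoLevelStructure hS)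

/-- Either analytic heart of the engine's negative lane — the planar witness-zero hypothesis `WitnessZeroExists` or the
holomorphic two-level structure `StiffTwoLevelStructure` — closes stmt-HubbardSuperconductivity-2082. [folklore] -/
theorem birGappedPhaseReduction_of_witnessZeroExists_or_stiffTwoLevelStructure
    (h : WitnessZeroExists ∨ StiffTwoLevelStructure) : BirGappedPhaseReduction :=
  h.elim birGappedPhaseReduction_of_witnessZeroExists birGappedPhaseReduction_of_stiffTwoLevelStructure

end Summit.HubbardSuperconductivity.HubbardSuperconductivity.Theorems
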